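import Mathlib
import Summits.ValiantsHypothesis.ValiantsHypothesis.Theorems.LiouvilleSarnakLiouvilleCutRankMultiplicativeBarrier

/-!
# Route LiouvilleSarnak — crux `DigitalBilinearLiouville` (stmt-ValiantsHypothesis-14774): the prime budget
# `{2, 3, 5, 7, 11}` does NOT decide the bilinear crux — a completely multiplicative twin with a DENSE ALL-ONES
# ALIGNED RECTANGLE at every level

`…ModEightBarrier.lean` (p834375) showed for the RANK crux `LiouvilleCutRank` that the smallest initial segment of
primes whose `λ`-signs are not reproduced by a completely multiplicative twin of bounded aligned cut rank is
`{2, 3, 5, 7}` (the three real characters of conductor `∣ 8`), and the relaxed-model numerics on its companion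
`…CycleCertificates.lean` suggest that this budget already forces many distinct rows.  For the BILINEAR crux the
situation is different in kind: here is a completely multiplicative `±1`-valued `f` with
`f(2) = f(3) = f(5) = f(7) = f(11) = -1` (`= λ` there; `f(13) = f(17) = 1`) — the `χ₁₇`-TWIN
`f(2^v 17^w M) = (-1)^v (M | 17)` (`M` prime to `34`; `3, 5, 6, 7, 10, 11, 12, 14` are the non-residues mod `17`) —
whose aligned cut matrices `(f(a + 2^n b + 1))_{a,b<2^n}` contain the ALL-ONES rectangle
`{136 ∣ a} × {17 ∣ b}` (★ `twin_eq_one_of_dvd`: `a + 2^n b + 1 ≡ 1 (mod 17)` is odd), of density `≥ 2^{-13}`; so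
the bilinear inequality of the crux fails for `f` with `ε = 2^{-14}` at EVERY level `n ≥ 8`
(★ `exists_completelyMultiplicative_budget11_bilinear_violated`: test vectors `𝟙_{136∣a}`, `𝟙_{17∣b}`), although
`f` has (numerically) FULL aligned cut rank (`126/128` at `n = 7`; this session's `numerics/twins3.py`).

The same construction works for every finite prime budget `B` (a prime `q ≡ 1 (mod 8)` with all odd `p ≤ B`
non-residues, by quadratic reciprocity + Dirichlet; rectangle `{8q ∣ a} × {q ∣ b}`; not formalised here), so:

PLANNING CONSEQUENCE (honest framing).  No finite amount of information `λ(p) = -1, p ≤ B` plus complete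
multiplicativity can prove `DigitalBilinearLiouville`, already its aligned instance or its monochromatic-rectangle
consequence (`…MonochromaticRectangles`): the bilinear crux is irreducibly analytic (non-pretentiousness of `λ` to
twisted characters of every conductor), whereas for the rank crux no such obstruction beyond conductor `8` is known.
Nothing here is a case of either crux; `LiouvilleCutRank`, `DigitalBilinearLiouville`, `AlgebraicSarnak` stay OPEN;
nothing bears on `VP ≠ VNP`.  No definitions (the witness is an explicit term).
-/

set_option linter.dupNamespace false

noncomputable section

namespace Summit.ValiantsHypothesis.ValiantsHypothesis.Theorems.LiouvilleSarnakDigitalBilinearLiouville.FiniteBudgetBarrier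

open Finset

open Summit.ValiantsHypothesis.ValiantsHypothesis.Theorems.LiouvilleSarnakLiouvilleCutRank.MultiplicativeBarrier
  (exists_eq_two_pow_mul_odd)

/-! ### §1 The quadratic character mod `17` in `±1` form on residues prime to `17` -/

/-- Multiplicativity of the `±1`-form of the Legendre symbol mod `17` on residues `1, …, 16` (finite check).
[folklore] -/
theorem sign17_mul_residues :
    ∀ r₁ < 17, ∀ r₂ < 17, r₁ ≠ 0 → r₂ ≠ 0 →
      (if (r₁ * r₂) % 17 = 3 ∨ (r₁ * r₂) % 17 = 5 ∨ (r₁ * r₂) % 17 = 6 ∨ (r₁ * r₂) % 17 = 7 ∨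
          (r₁ * r₂) % 17 = 10 ∨ (r₁ * r₂) % 17 = 11 ∨ (r₁ * r₂) % 17 = 12 ∨ (r₁ * r₂) % 17 = 14
        then (-1 : ℤ) else 1) =
      (if r₁ % 17 = 3 ∨ r₁ % 17 = 5 ∨ r₁ % 17 = 6 ∨ r₁ % 17 = 7 ∨
          r₁ % 17 = 10 ∨ r₁ % 17 = 11 ∨ r₁ % 17 = 12 ∨ r₁ % 17 = 14 then (-1 : ℤ) else 1) *
      (if r₂ % 17 = 3 ∨ r₂ % 17 = 5 ∨ r₂ % 17 = 6 ∨ r₂ % 17 = 7 ∨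
          r₂ % 17 = 10 ∨ r₂ % 17 = 11 ∨ r₂ % 17 = 12 ∨ r₂ % 17 = 14 then (-1 : ℤ) else 1) := by
  decide

/-- Multiplicativity of the `±1`-form of `(· | 17)` on naturals prime to `17`. [folklore] -/
theorem sign17_mul (M₁ M₂ : ℕ) (h₁ : M₁ % 17 ≠ 0) (h₂ : M₂ % 17 ≠ 0) :
    (if (M₁ * M₂) % 17 = 3 ∨ (M₁ * M₂) % 17 = 5 ∨ (M₁ * M₂) % 17 = 6 ∨ (M₁ * M₂) % 17 = 7 ∨
        (M₁ * M₂) % 17 = 10 ∨ (M₁ * M₂) % 17 = 11 ∨ (M₁ * M₂) % 17 = 12 ∨ (M₁ * M₂) % 17 = 14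
      then (-1 : ℤ) else 1) =
    (if M₁ % 17 = 3 ∨ M₁ % 17 = 5 ∨ M₁ % 17 = 6 ∨ M₁ % 17 = 7 ∨
        M₁ % 17 = 10 ∨ M₁ % 17 = 11 ∨ M₁ % 17 = 12 ∨ M₁ % 17 = 14 then (-1 : ℤ) else 1) *
    (if M₂ % 17 = 3 ∨ M₂ % 17 = 5 ∨ M₂ % 17 = 6 ∨ M₂ % 17 = 7 ∨
        M₂ % 17 = 10 ∨ M₂ % 17 = 11 ∨ M₂ % 17 = 12 ∨ M₂ % 17 = 14 then (-1 : ℤ) else 1) := by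
  have hm : (M₁ * M₂) % 17 = ((M₁ % 17) * (M₂ % 17)) % 17 := Nat.mul_mod _ _ _
  have key := sign17_mul_residues (M₁ % 17) (Nat.mod_lt _ (by norm_num)) (M₂ % 17)
    (Nat.mod_lt _ (by norm_num)) h₁ h₂
  rw [Nat.mod_mod, Nat.mod_mod] at key
  rw [hm]
  exact key

/-! ### §2 The decomposition `m = 2^v · 17^w · M`, `M` prime to `34` -/

/-- Every positive integer is `2^v · 17^w · M` with `M` odd and prime to `17`. [folklore] -/
theorem exists_eq_two_pow_mul_sev_pow_mul (m : ℕ) (hm : m ≠ 0) :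
    ∃ v w M : ℕ, M % 2 = 1 ∧ M % 17 ≠ 0 ∧ m = 2 ^ v * 17 ^ w * M := by
  obtain ⟨v, m₁, hm₁, rfl⟩ := exists_eq_two_pow_mul_odd m hm
  have hm₁0 : m₁ ≠ 0 := by intro h; simp [h] at hm₁
  have h17 : Nat.Prime 17 := by norm_num
  refine ⟨v, m₁.factorization 17, m₁ / 17 ^ m₁.factorization 17, ?_, ?_, ?_⟩
  · -- the `17`-free part of an odd number is odd
    have hdvd : m₁ / 17 ^ m₁.factorization 17 ∣ m₁ := Nat.ordCompl_dvd m₁ 17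
    have h2 : ¬ 2 ∣ m₁ / 17 ^ m₁.factorization 17 := fun h => by
      have : 2 ∣ m₁ := dvd_trans h hdvd
      omega
    omega
  · have h := Nat.not_dvd_ordCompl h17 hm₁0
    intro h0
    exact h (Nat.dvd_of_mod_eq_zero h0)
  · rw [mul_assoc, Nat.ordProj_mul_ordCompl_eq_self]

/-- The witness evaluated at `2^v · 17^w · M` (`M` odd, prime to `17`): `(-1)^v · (M | 17)`. [folklore] -/
theorem witness_apply (v w M : ℕ) (hM2 : M % 2 = 1) (hM17 : M % 17 ≠ 0) :
    (fun m : ℕ => (-1 : ℤ) ^ (m.factorization 2) *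
        (if (m / 2 ^ (m.factorization 2) / 17 ^ (m.factorization 17)) % 17 = 3 ∨
            (m / 2 ^ (m.factorization 2) / 17 ^ (m.factorization 17)) % 17 = 5 ∨
            (m / 2 ^ (m.factorization 2) / 17 ^ (m.factorization 17)) % 17 = 6 ∨
            (m / 2 ^ (m.factorization 2) / 17 ^ (m.factorization 17)) % 17 = 7 ∨
            (m / 2 ^ (m.factorization 2) / 17 ^ (m.factorization 17)) % 17 = 10 ∨
            (m / 2 ^ (m.factorization 2) / 17 ^ (m.factorization 17)) % 17 = 11 ∨
            (m / 2 ^ (m.factorization 2) / 17 ^ (m.factorization 17)) % 17 = 12 ∨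
            (m / 2 ^ (m.factorization 2) / 17 ^ (m.factorization 17)) % 17 = 14
          then -1 else 1)) (2 ^ v * 17 ^ w * M) =
      (-1 : ℤ) ^ v *
        (if M % 17 = 3 ∨ M % 17 = 5 ∨ M % 17 = 6 ∨ M % 17 = 7 ∨
            M % 17 = 10 ∨ M % 17 = 11 ∨ M % 17 = 12 ∨ M % 17 = 14 then -1 else 1) := by
  have hM0 : M ≠ 0 := by intro h; simp [h] at hM2
  have h17 : Nat.Prime 17 := by norm_num
  have hfac2 : (2 ^ v * 17 ^ w * M).factorization 2 = v := by
    rw [Nat.factorization_mul (mul_ne_zero (pow_ne_zero _ two_ne_zero) (pow_ne_zero _ (by norm_num))) hM0,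
      Nat.factorization_mul (pow_ne_zero _ two_ne_zero) (pow_ne_zero _ (by norm_num)),
      Finsupp.add_apply, Finsupp.add_apply, Nat.Prime.factorization_pow Nat.prime_two,
      Finsupp.single_eq_same, Nat.Prime.factorization_pow h17, Finsupp.single_apply, if_neg (by norm_num),
      Nat.factorization_eq_zero_of_not_dvd (fun h => by omega)]
    simp
  have hfac17 : (2 ^ v * 17 ^ w * M).factorization 17 = w := by
    rw [Nat.factorization_mul (mul_ne_zero (pow_ne_zero _ two_ne_zero) (pow_ne_zero _ (by norm_num))) hM0,
      Nat.factorization_mul (pow_ne_zero _ two_ne_zero) (pow_ne_zero _ (by norm_num)),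
      Finsupp.add_apply, Finsupp.add_apply, Nat.Prime.factorization_pow Nat.prime_two,
      Finsupp.single_apply, if_neg (by norm_num), Nat.Prime.factorization_pow h17, Finsupp.single_eq_same,
      Nat.factorization_eq_zero_of_not_dvd (fun h => hM17 (Nat.mod_eq_zero_of_dvd h))]
    simp
  have hdiv : 2 ^ v * 17 ^ w * M / 2 ^ v / 17 ^ w = M := by
    rw [mul_assoc, Nat.mul_div_cancel_left _ (Nat.two_pow_pos v),
      Nat.mul_div_cancel_left _ (pow_pos (by norm_num) w)]
  simp only [hfac2, hfac17, hdiv]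

/-! ### §3 The barrier -/

/-- ★ **A finite prime budget does not decide the bilinear crux.**  There is a completely multiplicative
`f : ℕ → ℤ`, `±1`-valued on the positive integers, with `f(2) = f(3) = f(5) = f(7) = f(11) = -1` (the values of
`λ`) and `f(13) = f(17) = 1`, such that at every level `n ≥ 1` the aligned cut matrix `(f(a + 2^n b + 1))_{a,b}`
is identically `1` on the rectangle `{136 ∣ a} × {17 ∣ b}`, and consequently for every `n ≥ 8` the bilinear
inequality of `DigitalBilinearLiouville` (aligned cut, `ε = 2^{-14}`) FAILS for `f`: with `u = 𝟙_{136 ∣ a}`,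
`w = 𝟙_{17 ∣ b}` one has `|Σ u_a w_b f(a + 2^n b + 1)|² > 2^{-14} · 4^n · ‖u‖² · ‖w‖²`.
Witness: `f(2^v 17^w M) = (-1)^v (M | 17)`. [folklore] -/
theorem exists_completelyMultiplicative_budget11_bilinear_violated :
    ∃ f : ℕ → ℤ, (∀ m, 1 ≤ m → f m = 1 ∨ f m = -1) ∧ (∀ a b, 1 ≤ a → 1 ≤ b → f (a * b) = f a * f b) ∧
      f 2 = -1 ∧ f 3 = -1 ∧ f 5 = -1 ∧ f 7 = -1 ∧ f 11 = -1 ∧ f 13 = 1 ∧ f 17 = 1 ∧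
      (∀ n a b : ℕ, 1 ≤ n → 136 ∣ a → 17 ∣ b → f (a + 2 ^ n * b + 1) = 1) ∧
      ∀ n, 8 ≤ n → ∃ u w : Fin (2 ^ n) → ℂ,
        (1 / 2 ^ 14 : ℝ) * 4 ^ n * (∑ a, ‖u a‖ ^ 2) * (∑ b, ‖w b‖ ^ 2) <
          ‖∑ a : Fin (2 ^ n), ∑ b : Fin (2 ^ n),
            u a * w b * ((f ((a : ℕ) + 2 ^ n * (b : ℕ) + 1) : ℤ) : ℂ)‖ ^ 2 := by
  classical
  let f : ℕ → ℤ := fun m => (-1 : ℤ) ^ (m.factorization 2) *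
        (if (m / 2 ^ (m.factorization 2) / 17 ^ (m.factorization 17)) % 17 = 3 ∨
            (m / 2 ^ (m.factorization 2) / 17 ^ (m.factorization 17)) % 17 = 5 ∨
            (m / 2 ^ (m.factorization 2) / 17 ^ (m.factorization 17)) % 17 = 6 ∨
            (m / 2 ^ (m.factorization 2) / 17 ^ (m.factorization 17)) % 17 = 7 ∨
            (m / 2 ^ (m.factorization 2) / 17 ^ (m.factorization 17)) % 17 = 10 ∨
            (m / 2 ^ (m.factorization 2) / 17 ^ (m.factorization 17)) % 17 = 11 ∨
            (m / 2 ^ (m.factorization 2) / 17 ^ (m.factorization 17)) % 17 = 12 ∨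
            (m / 2 ^ (m.factorization 2) / 17 ^ (m.factorization 17)) % 17 = 14
          then -1 else 1)
  have hf : ∀ v w M : ℕ, M % 2 = 1 → M % 17 ≠ 0 → f (2 ^ v * 17 ^ w * M) = (-1 : ℤ) ^ v *
      (if M % 17 = 3 ∨ M % 17 = 5 ∨ M % 17 = 6 ∨ M % 17 = 7 ∨
          M % 17 = 10 ∨ M % 17 = 11 ∨ M % 17 = 12 ∨ M % 17 = 14 then -1 else 1) :=
    fun v w M h2 h17 => witness_apply v w M h2 h17
  -- values on numbers prime to `34`
  have hunit : ∀ M : ℕ, M % 2 = 1 → M % 17 ≠ 0 → f M =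
      (if M % 17 = 3 ∨ M % 17 = 5 ∨ M % 17 = 6 ∨ M % 17 = 7 ∨
          M % 17 = 10 ∨ M % 17 = 11 ∨ M % 17 = 12 ∨ M % 17 = 14 then -1 else 1) := by
    intro M h2 h17
    have := hf 0 0 M h2 h17
    simpa using this
  refine ⟨f, fun m hm => ?_, fun a b ha hb => ?_, ?_, ?_, ?_, ?_, ?_, ?_, ?_, fun n a b hn ha hb => ?_,
    fun n hn => ?_⟩
  · -- values `±1`
    obtain ⟨v, w, M, hM2, hM17, rfl⟩ := exists_eq_two_pow_mul_sev_pow_mul m (by omega)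
    rw [hf v w M hM2 hM17]
    rcases neg_one_pow_eq_or ℤ v with h | h <;> rw [h] <;> split_ifs <;> simp
  · -- complete multiplicativity
    obtain ⟨v, w, M, hM2, hM17, rfl⟩ := exists_eq_two_pow_mul_sev_pow_mul a (by omega)
    obtain ⟨v', w', M', hM2', hM17', rfl⟩ := exists_eq_two_pow_mul_sev_pow_mul b (by omega)
    have hMM2 : (M * M') % 2 = 1 := by
      have := Nat.mul_mod M M' 2; rw [hM2, hM2'] at this; simpa using this
    have hMM17 : (M * M') % 17 ≠ 0 := by
      intro h
      have h17 : Nat.Prime 17 := by norm_num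
      rcases (Nat.Prime.dvd_mul h17).mp (Nat.dvd_of_mod_eq_zero h) with h1 | h1
      · exact hM17 (Nat.mod_eq_zero_of_dvd h1)
      · exact hM17' (Nat.mod_eq_zero_of_dvd h1)
    rw [show 2 ^ v * 17 ^ w * M * (2 ^ v' * 17 ^ w' * M') = 2 ^ (v + v') * 17 ^ (w + w') * (M * M') by ring,
      hf _ _ _ hMM2 hMM17, hf v w M hM2 hM17, hf v' w' M' hM2' hM17', sign17_mul M M' hM17 hM17', pow_add]
    ring
  · -- `f 2 = -1`
    have := hf 1 0 1 (by norm_num) (by norm_num)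
    simpa using this
  · rw [hunit 3 (by norm_num) (by norm_num)]; norm_num
  · rw [hunit 5 (by norm_num) (by norm_num)]; norm_num
  · rw [hunit 7 (by norm_num) (by norm_num)]; norm_num
  · rw [hunit 11 (by norm_num) (by norm_num)]; norm_num
  · rw [hunit 13 (by norm_num) (by norm_num)]; norm_num
  · -- `f 17 = 1`
    have := hf 0 1 1 (by norm_num) (by norm_num)
    simpa using this
  · -- the all-ones rectangle: `a + 2^n b + 1 ≡ 1 (mod 34)` essentially
    obtain ⟨s, rfl⟩ := ha
    obtain ⟨t, rfl⟩ := hb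
    obtain ⟨n', rfl⟩ : ∃ n', n = n' + 1 := ⟨n - 1, by omega⟩
    have h2 : (136 * s + 2 ^ (n' + 1) * (17 * t) + 1) % 2 = 1 := by
      have : 136 * s + 2 ^ (n' + 1) * (17 * t) + 1 = 2 * (68 * s + 2 ^ n' * 17 * t) + 1 := by ring
      rw [this]; omega
    have h17 : (136 * s + 2 ^ (n' + 1) * (17 * t) + 1) % 17 = 1 := by
      have : 136 * s + 2 ^ (n' + 1) * (17 * t) + 1 = 17 * (8 * s + 2 ^ (n' + 1) * t) + 1 := by ring
      rw [this]; omega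
    rw [hunit _ h2 (by rw [h17]; norm_num), h17]
    norm_num
  · -- the bilinear violation at level `n ≥ 8`
    -- the rectangle property at this level
    have hrect : ∀ a b : ℕ, 136 ∣ a → 17 ∣ b → f (a + 2 ^ n * b + 1) = 1 := by
      intro a b ha hb
      obtain ⟨s, rfl⟩ := ha
      obtain ⟨t, rfl⟩ := hb
      obtain ⟨n', rfl⟩ : ∃ n', n = n' + 1 := ⟨n - 1, by omega⟩
      have h2 : (136 * s + 2 ^ (n' + 1) * (17 * t) + 1) % 2 = 1 := by
        have : 136 * s + 2 ^ (n' + 1) * (17 * t) + 1 = 2 * (68 * s + 2 ^ n' * 17 * t) + 1 := by ring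
        rw [this]; omega
      have h17 : (136 * s + 2 ^ (n' + 1) * (17 * t) + 1) % 17 = 1 := by
        have : 136 * s + 2 ^ (n' + 1) * (17 * t) + 1 = 17 * (8 * s + 2 ^ (n' + 1) * t) + 1 := by ring
        rw [this]; omega
      rw [hunit _ h2 (by rw [h17]; norm_num), h17]
      norm_num
    let u : Fin (2 ^ n) → ℂ := fun a => if 136 ∣ (a : ℕ) then 1 else 0
    let w : Fin (2 ^ n) → ℂ := fun b => if 17 ∣ (b : ℕ) then 1 else 0
    refine ⟨u, w, ?_⟩
    set A : Finset (Fin (2 ^ n)) :=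
      (Finset.univ : Finset (Fin (2 ^ n))).filter (fun a : Fin (2 ^ n) => 136 ∣ (a : ℕ)) with hA
    set B : Finset (Fin (2 ^ n)) :=
      (Finset.univ : Finset (Fin (2 ^ n))).filter (fun b : Fin (2 ^ n) => 17 ∣ (b : ℕ)) with hB
    -- norms
    have hu : (∑ a, ‖u a‖ ^ 2) = (A.card : ℝ) := by
      have : ∀ a : Fin (2 ^ n), ‖u a‖ ^ 2 = if 136 ∣ (a : ℕ) then (1 : ℝ) else 0 := by
        intro a; by_cases h : 136 ∣ (a : ℕ) <;> simp [u, h]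
      simp_rw [this]
      rw [Finset.sum_boole, hA]
    have hw : (∑ b, ‖w b‖ ^ 2) = (B.card : ℝ) := by
      have : ∀ b : Fin (2 ^ n), ‖w b‖ ^ 2 = if 17 ∣ (b : ℕ) then (1 : ℝ) else 0 := by
        intro b; by_cases h : 17 ∣ (b : ℕ) <;> simp [w, h]
      simp_rw [this]
      rw [Finset.sum_boole, hB]
    -- the bilinear sum equals `#A · #B`
    have hsum : (∑ a : Fin (2 ^ n), ∑ b : Fin (2 ^ n),
        u a * w b * ((f ((a : ℕ) + 2 ^ n * (b : ℕ) + 1) : ℤ) : ℂ)) = (A.card : ℂ) * (B.card : ℂ) := by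
      have hterm : ∀ a b : Fin (2 ^ n), u a * w b * ((f ((a : ℕ) + 2 ^ n * (b : ℕ) + 1) : ℤ) : ℂ) =
          (if 136 ∣ (a : ℕ) then (1 : ℂ) else 0) * (if 17 ∣ (b : ℕ) then (1 : ℂ) else 0) := by
        intro a b
        by_cases ha : 136 ∣ (a : ℕ)
        · by_cases hb : 17 ∣ (b : ℕ)
          · simp [u, w, ha, hb, hrect a b ha hb]
          · simp [u, w, hb]
        · simp [u, ha]
      simp_rw [hterm, ← Finset.mul_sum, ← Finset.sum_mul]
      rw [Finset.sum_boole, Finset.sum_boole, hA, hB]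
    -- lower bounds for `#A` and `#B`
    have hApow : 2 ^ (n - 8) ≤ A.card := by
      have hle : 2 ^ (n - 8) * 136 ≤ 2 ^ n := by
        calc 2 ^ (n - 8) * 136 ≤ 2 ^ (n - 8) * 2 ^ 8 := Nat.mul_le_mul_left _ (by norm_num)
          _ = 2 ^ n := by rw [← pow_add]; congr 1; omega
      let ι : Fin (2 ^ (n - 8)) → Fin (2 ^ n) := fun t => ⟨136 * (t : ℕ), by have := t.isLt; omega⟩
      have hinj : Function.Injective ι := by
        intro t t' h
        have := congrArg (fun x : Fin (2 ^ n) => (x : ℕ)) h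
        simp only [ι] at this
        exact Fin.ext (by omega)
      have hsub : Finset.univ.image ι ⊆ A := by
        intro x hx
        obtain ⟨t, -, rfl⟩ := Finset.mem_image.mp hx
        rw [hA, Finset.mem_filter]
        exact ⟨Finset.mem_univ _, ⟨(t : ℕ), rfl⟩⟩
      calc 2 ^ (n - 8) = (Finset.univ.image ι).card := by
            rw [Finset.card_image_of_injective _ hinj, Finset.card_univ, Fintype.card_fin]
        _ ≤ A.card := Finset.card_le_card hsub
    have hBpow : 2 ^ (n - 5) ≤ B.card := by
      have hle : 2 ^ (n - 5) * 17 ≤ 2 ^ n := by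
        calc 2 ^ (n - 5) * 17 ≤ 2 ^ (n - 5) * 2 ^ 5 := Nat.mul_le_mul_left _ (by norm_num)
          _ = 2 ^ n := by rw [← pow_add]; congr 1; omega
      let ι : Fin (2 ^ (n - 5)) → Fin (2 ^ n) := fun t => ⟨17 * (t : ℕ), by have := t.isLt; omega⟩
      have hinj : Function.Injective ι := by
        intro t t' h
        have := congrArg (fun x : Fin (2 ^ n) => (x : ℕ)) h
        simp only [ι] at this
        exact Fin.ext (by omega)
      have hsub : Finset.univ.image ι ⊆ B := by
        intro x hx
        obtain ⟨t, -, rfl⟩ := Finset.mem_image.mp hx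
        rw [hB, Finset.mem_filter]
        exact ⟨Finset.mem_univ _, ⟨(t : ℕ), rfl⟩⟩
      calc 2 ^ (n - 5) = (Finset.univ.image ι).card := by
            rw [Finset.card_image_of_injective _ hinj, Finset.card_univ, Fintype.card_fin]
        _ ≤ B.card := Finset.card_le_card hsub
    -- `2^14 · #A · #B ≥ 2 · 4^n > 4^n`
    have hAB : (4 : ℝ) ^ n < 2 ^ 14 * (A.card : ℝ) * (B.card : ℝ) := by
      have h1 : (2 : ℝ) ^ (n - 8) ≤ A.card := by exact_mod_cast hApow
      have h2 : (2 : ℝ) ^ (n - 5) ≤ B.card := by exact_mod_cast hBpow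
      have h3 : (4 : ℝ) ^ n < 2 ^ 14 * (2 : ℝ) ^ (n - 8) * (2 : ℝ) ^ (n - 5) := by
        rw [show (4 : ℝ) = 2 ^ 2 by norm_num, ← pow_mul, ← pow_add, ← pow_add]
        exact pow_lt_pow_right₀ (by norm_num) (by omega)
      calc (4 : ℝ) ^ n < 2 ^ 14 * (2 : ℝ) ^ (n - 8) * (2 : ℝ) ^ (n - 5) := h3
        _ ≤ 2 ^ 14 * (A.card : ℝ) * (B.card : ℝ) := by gcongr
    rw [hsum, hu, hw]
    have hA1 : (2 : ℝ) ^ (n - 8) ≤ A.card := by exact_mod_cast hApow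
    have hB1 : (2 : ℝ) ^ (n - 5) ≤ B.card := by exact_mod_cast hBpow
    have hApos : (0 : ℝ) < A.card := lt_of_lt_of_le (by positivity) hA1
    have hBpos : (0 : ℝ) < B.card := lt_of_lt_of_le (by positivity) hB1
    rw [show ‖((A.card : ℂ) * (B.card : ℂ))‖ = (A.card : ℝ) * (B.card : ℝ) by
      rw [norm_mul]; simp]
    have : (1 / 2 ^ 14 : ℝ) * 4 ^ n * (A.card : ℝ) * (B.card : ℝ) <
        (A.card : ℝ) * (B.card : ℝ) * ((A.card : ℝ) * (B.card : ℝ)) := by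
      have h := mul_lt_mul_of_pos_right hAB (mul_pos hApos hBpos)
      nlinarith
    simpa [pow_two] using this

end Summit.ValiantsHypothesis.ValiantsHypothesis.Theorems.LiouvilleSarnakDigitalBilinearLiouville.FiniteBudgetBarrier
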